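import Mathlib
import HarnessLib
import Literature.MathematicalPhysics.QuantumLattice.GaugeGroups
import Literature.LinearAlgebra.Matrix.UnitaryGroupMaximalTorus
import Literature.LinearAlgebra.Matrix.SpecialUnitaryGroupConjugacyClasses
import Summits.Ventures.LatticeQCDFlow.Exactness.FlowPushforward
import Summits.Ventures.LatticeQCDFlow.Exactness.KernelJacobianChart
import Summits.Ventures.LatticeQCDFlow.Exactness.CircleGroupJacobian
import Summits.Ventures.LatticeQCDFlow.Exactness.SpectralKernelJacobianWeylShapeSU
import Summits.Ventures.LatticeQCDFlow.Exactness.TorusCircleChart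

/-!
# The `SU(2)` spectral flow's torus Jacobian: a monotone `C¹` map of the Weyl alcove `[0, π]` gives `HasJacobian (Haar SΔ(2))` with its derivative — hypothesis `hfJ` discharged for `N = 2`

HONEST FRAMING: exact (Metropolis-corrected) sampling algorithms for lattice gauge theory;
figures of merit are autocorrelation/cost numbers at stated couplings and volumes; no
continuum-physics claim.

Venture `LatticeQCDFlow` (cell pub-lqcd), topic `Exactness`; FANOUT row 10 (`eng-equiv`, engine
`latflow.equiv` / `latflow.flows_jax`, `spectral.py` `spectral_kernel` with `N = 2`, `cell = 'simplex'`: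
eigen-phases `±θ` ↦ canonical cell `x = (−a, a)`, `a = |θ| ∈ [0, π]` ↦ box coordinate
`α = ζ⁻¹(x) = 1 − a/π` ↦ spline `α' = χ(α)` ↦ `a' = π(1 − α')`, booked `log χ'(α)`; Boyda et al.,
PRD 103 (2021) 074504, App. B Algorithms 1–2 and the `SU(2)` flows of §IV).  NEW WORK of the cell
over Mathlib (one-variable change of variables `lintegral_image_eq_lintegral_deriv_mul_of_monotoneOn`;
`AddCircle.measurePreserving_mk`), row 14's `CircleGroupJacobian.map_circleEquiv_volume` and this
row's `TorusCircleChart.lean` (`map_eq_haarProbability_of_mul_of_surjective`, `HasJacobian.add`,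
`HasJacobian.smul_measure`).  Nothing is cited as a fact; no number; no definition (the torus chart
`z ↦ diag(z, z⁻¹)` enters through the characterising hypothesis `hc` and an existence theorem).

`SpectralKernelJacobianWeylShapeSU.hasJacobian_spectralKernel_specialUnitaryGroup_of_weyl` takes
the torus Jacobian `hfJ : HasJacobian (haarProbability (specialDiagonalTorus n)) fT Jf` as a
hypothesis.  For `n = Fin 2` the torus map of a permutation-equivariant eigenvalue flow is
determined by ONE monotone map `g` of the closed Weyl alcove `[0, π]` (half the phase gap):
`fT (diag(e^{ia}, e^{−ia})) = diag(e^{ig(a)}, e^{−ig(a)})` and, by equivariance under the swap,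
`fT (diag(e^{−ia}, e^{ia})) = diag(e^{−ig(a)}, e^{ig(a)})`.  This file proves `hfJ` from that:

* `hasJacobian_of_presentation_ae` — the transport lemma of `TorusCircleChart.lean` with the
  intertwining and the Jacobian identity required only `π`-a.e.;
* **`hasJacobian_volume_restrict_of_monotoneOn`** — a measurable `g`, monotone on a measurable
  `I ⊆ ℝ` with `g '' I = I` and derivative `g'` within `I`, has `HasJacobian (volume|I) g (ofReal ∘ g')`
  (the box-spline certificate, one coordinate);
* the torus of `SU(2)`: `diagonal_pair_mem_specialUnitaryGroup`, **`exists_su2TorusChart`**,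
  `su2TorusChart_mul`, `su2TorusChart_surjective_continuous`,
  **`map_su2TorusChart_haar`** (`c_* Haar_{U(1)} = Haar_{SΔ(2)}`),
  **`haarProbability_circle_eq_map_exp`** (`Haar_{U(1)} = (2π)⁻¹ · exp_* Leb|_(−π,π]`),
  **`haarProbability_su2Torus_eq_alcoves`** — `Haar_{SΔ(2)} = (2π)⁻¹ · (E₊_* Leb|_[0,π] + E₋_* Leb|_[0,π])`
  with `E_±(a) = diag(e^{±ia}, e^{∓ia})`: the two Weyl chambers, each presented by the alcove;
* **`hasJacobian_su2Torus_of_alcoveMap`** — `hfJ` for `N = 2`: a measurable `fT` with measurable `Jf`,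
  intertwined on both chambers with a monotone alcove map `g` (`g '' [0,π] = [0,π]`, derivative `g'`
  within `[0,π]`) and `Jf (E_±(a)) = g'(a)`, satisfies `HasJacobian (Haar SΔ(2)) fT Jf`;
* **`hasJacobian_su2Torus_of_boxFlow`** — the engine's parametrisation: `g(a) = π(1 − χ(1 − a/π))`,
  `Jf (E_±(a)) = χ'(1 − a/π)` for a monotone `χ` of `[0,1]` onto itself with derivative `χ'` within
  `[0,1]` (the one-coordinate rational-quadratic spline of `RationalQuadraticSpline.lean`).

NOT here: Weyl's integral formula for `SU(2)` (the other hypothesis, `hW`); `N ≥ 3` (the alcove is a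
simplex and the chart is not a product); any number.
-/

noncomputable section

namespace Summit.Ventures.LatticeQCDFlow.Exactness

open MeasureTheory Matrix Topology Set Real
open Literature.LinearAlgebra.Matrix
open Literature.MathematicalPhysics.QuantumFieldTheory (haarProbability)
open scoped ENNReal

/-! ## Transport along a presentation, almost-everywhere form -/

section Presentation

variable {X Ω : Type*} [MeasurableSpace X] [MeasurableSpace Ω]

/-- **Transport of a Jacobian along a presentation (a.e. form).**  As
`hasJacobian_of_presentation`, with `F ∘ e = e ∘ F'` and `J ∘ e = J'` required only `ρ`-a.e. -/
theorem hasJacobian_of_presentation_ae {ρ : Measure X} {vol : Measure Ω} {e : X → Ω}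
    (he : Measurable e) (hρ : Measure.map e ρ = vol) {F' : X → X} {J' : X → ℝ≥0∞}
    (hF' : HasJacobian ρ F' J') {F : Ω → Ω} (hF : Measurable F) {J : Ω → ℝ≥0∞} (hJ : Measurable J)
    (hcomm : ∀ᵐ x ∂ρ, F (e x) = e (F' x)) (hJ' : ∀ᵐ x ∂ρ, J (e x) = J' x) : HasJacobian vol F J where
  measurable := hF
  measurable_jac := hJ
  map_eq := by
    have h1 : ρ.withDensity (J ∘ e) = ρ.withDensity J' := withDensity_congr_ae hJ'
    have h2 : (F ∘ e) =ᵐ[ρ.withDensity J'] (e ∘ F') :=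
      (withDensity_absolutelyContinuous ρ J') hcomm
    rw [← hρ, withDensity_map_eq_map_withDensity_comp he hJ, Measure.map_map hF he, h1,
      Measure.map_congr h2, ← Measure.map_map he hF'.measurable, hF'.map_eq]

end Presentation

/-! ## One coordinate: a monotone `C¹` map of an interval onto itself -/

/-- **The one-coordinate spline certificate.**  Let `I ⊆ ℝ` be measurable, `g` measurable and
monotone on `I` with `g '' I = I`, with derivative `g'` (measurable) within `I` at every point of
`I`.  Then `g_* (g' · Leb|_I) = Leb|_I`: `HasJacobian (volume.restrict I) g (ofReal ∘ g')`. -/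
theorem hasJacobian_volume_restrict_of_monotoneOn {I : Set ℝ} (hI : MeasurableSet I) {g g' : ℝ → ℝ}
    (hg : Measurable g) (hg' : Measurable g') (hderiv : ∀ x ∈ I, HasDerivWithinAt g (g' x) I x)
    (hmono : MonotoneOn g I) (himage : g '' I = I) :
    HasJacobian (volume.restrict I) g fun x => ENNReal.ofReal (g' x) where
  measurable := hg
  measurable_jac := ENNReal.measurable_ofReal.comp hg'
  map_eq := by
    ext s hs
    have hS : MeasurableSet (I ∩ g ⁻¹' s) := hI.inter (hg hs)
    rw [Measure.map_apply hg hs, withDensity_apply _ (hg hs), Measure.restrict_restrict (hg hs),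
      Measure.restrict_apply hs, Set.inter_comm (g ⁻¹' s) I]
    have himg : g '' (I ∩ g ⁻¹' s) = s ∩ I := by rw [Set.image_inter_preimage, himage, Set.inter_comm]
    have h := lintegral_image_eq_lintegral_deriv_mul_of_monotoneOn hS
      (fun x hx => (hderiv x hx.1).mono Set.inter_subset_left) (hmono.mono Set.inter_subset_left) 1
    simp only [Pi.one_apply, mul_one, lintegral_one, Measure.restrict_apply MeasurableSet.univ,
      Set.univ_inter, himg] at h
    exact h.symm

/-! ## The torus of `SU(2)`: `z ↦ diag(z, z⁻¹)` -/

/-- `diag(z, z⁻¹) ∈ SU(2)` for `z ∈ U(1)`. -/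
theorem diagonal_pair_mem_specialUnitaryGroup (z : Circle) :
    diagonal ![(z : ℂ), ((z⁻¹ : Circle) : ℂ)] ∈ Matrix.specialUnitaryGroup (Fin 2) ℂ := by
  refine (Literature.MathematicalPhysics.QuantumLattice.diagonal_mem_specialUnitaryGroup_iff _).mpr
    ⟨fun i => ?_, ?_⟩
  · fin_cases i
    · exact Circle.norm_coe z
    · exact Circle.norm_coe z⁻¹
  · rw [Fin.prod_univ_two, Matrix.cons_val_zero, Matrix.cons_val_one, Matrix.cons_val_zero,
      ← Circle.coe_mul, mul_inv_cancel, Circle.coe_one]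

/-- **The torus chart of `SU(2)` exists and is continuous**: `z ↦ diag(z, z⁻¹) ∈ SΔ(2)`. -/
theorem exists_su2TorusChart :
    ∃ c : Circle → specialDiagonalTorus (Fin 2), Continuous c ∧
      ∀ z, (((c z : specialDiagonalTorus (Fin 2)) : Matrix.specialUnitaryGroup (Fin 2) ℂ) :
        Matrix (Fin 2) (Fin 2) ℂ) = diagonal ![(z : ℂ), ((z⁻¹ : Circle) : ℂ)] := by
  refine ⟨fun z => ⟨⟨diagonal ![(z : ℂ), ((z⁻¹ : Circle) : ℂ)], diagonal_pair_mem_specialUnitaryGroup z⟩,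
    ⟨_, rfl⟩⟩, ?_, fun z => rfl⟩
  refine continuous_induced_rng.2 (continuous_induced_rng.2 ?_)
  change Continuous fun z : Circle => diagonal ![(z : ℂ), ((z⁻¹ : Circle) : ℂ)]
  refine Continuous.matrix_diagonal (continuous_pi fun i => ?_)
  fin_cases i
  · exact continuous_subtype_val
  · exact continuous_subtype_val.comp continuous_inv

variable {c : Circle → specialDiagonalTorus (Fin 2)}
  (hc : ∀ z, (((c z : specialDiagonalTorus (Fin 2)) : Matrix.specialUnitaryGroup (Fin 2) ℂ) :
    Matrix (Fin 2) (Fin 2) ℂ) = diagonal ![(z : ℂ), ((z⁻¹ : Circle) : ℂ)])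

include hc

/-- The chart is multiplicative. -/
theorem su2TorusChart_mul (z w : Circle) : c (z * w) = c z * c w := by
  apply Subtype.ext
  apply Subtype.ext
  change (((c (z * w) : specialDiagonalTorus (Fin 2)) : Matrix.specialUnitaryGroup (Fin 2) ℂ) :
      Matrix (Fin 2) (Fin 2) ℂ) =
    (((c z : specialDiagonalTorus (Fin 2)) : Matrix.specialUnitaryGroup (Fin 2) ℂ) : Matrix (Fin 2) (Fin 2) ℂ) *
      (((c w : specialDiagonalTorus (Fin 2)) : Matrix.specialUnitaryGroup (Fin 2) ℂ) : Matrix (Fin 2) (Fin 2) ℂ)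
  rw [hc, hc, hc, diagonal_mul_diagonal]
  refine congrArg diagonal (funext fun i => ?_)
  fin_cases i
  · simp
  · simp [mul_comm]

/-- **The chart is a continuous surjection onto `SΔ(2)`** (a point of `SΔ(2)` is `diag(z, z⁻¹)`
with `z` its first entry; the matrix entries are continuous in `z`). -/
theorem su2TorusChart_surjective_continuous : Function.Surjective c ∧ Continuous c := by
  refine ⟨?_, ?_⟩
  · intro t
    have hdiag := coe_specialDiagonalTorus_eq_diagonal t
    set d : Fin 2 → ℂ := fun i => ((t : Matrix.specialUnitaryGroup (Fin 2) ℂ) : Matrix (Fin 2) (Fin 2) ℂ) i i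
      with hd
    obtain ⟨hd1, hprod⟩ := norm_eq_one_and_prod_eq_one_of_mem_specialDiagonalTorus hdiag
    rw [Fin.prod_univ_two] at hprod
    refine ⟨⟨d 0, mem_sphere_zero_iff_norm.mpr (hd1 0)⟩, ?_⟩
    apply Subtype.ext
    apply Subtype.ext
    rw [hc, hdiag]
    refine congrArg diagonal (funext fun i => ?_)
    fin_cases i
    · rfl
    · change (((⟨d 0, _⟩ : Circle)⁻¹ : Circle) : ℂ) = d 1
      rw [Circle.coe_inv]
      exact inv_eq_of_mul_eq_one_right hprod
  · refine continuous_induced_rng.2 (continuous_induced_rng.2 ?_)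
    have hfun : (fun z => (((c z : specialDiagonalTorus (Fin 2)) : Matrix.specialUnitaryGroup (Fin 2) ℂ) :
        Matrix (Fin 2) (Fin 2) ℂ)) = fun z : Circle => diagonal ![(z : ℂ), ((z⁻¹ : Circle) : ℂ)] :=
      funext hc
    change Continuous fun z => (((c z : specialDiagonalTorus (Fin 2)) : Matrix.specialUnitaryGroup (Fin 2) ℂ) :
        Matrix (Fin 2) (Fin 2) ℂ)
    rw [hfun]
    refine Continuous.matrix_diagonal (continuous_pi fun i => ?_)
    fin_cases i
    · exact continuous_subtype_val
    · exact continuous_subtype_val.comp continuous_inv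

/-- **The chart presents Haar**: `c_* Haar_{U(1)} = Haar_{SΔ(2)}` (uniqueness of Haar measure). -/
theorem map_su2TorusChart_haar : Measure.map c (haarProbability Circle) =
    haarProbability (specialDiagonalTorus (Fin 2)) := by
  haveI : SecondCountableTopology (specialDiagonalTorus (Fin 2)) := secondCountableTopology_specialDiagonalTorus
  exact map_eq_haarProbability_of_mul_of_surjective _ (su2TorusChart_surjective_continuous hc).2.measurable
    (su2TorusChart_mul hc) (su2TorusChart_surjective_continuous hc).1

omit hc in
/-- **Haar on `U(1)` is the uniform angle**: `Haar_{U(1)} = (2π)⁻¹ · exp_* Leb|_(−π, π]`. -/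
theorem haarProbability_circle_eq_map_exp : haarProbability Circle =
    (ENNReal.ofReal (2 * π))⁻¹ • Measure.map (fun θ : ℝ => Circle.exp θ) (volume.restrict (Ioc (-π) π)) := by
  haveI : Fact (0 < 2 * π) := ⟨by positivity⟩
  have hmk := (AddCircle.measurePreserving_mk (2 * π) (-π)).map_eq
  have hI : (-π + 2 * π : ℝ) = π := by ring
  rw [hI] at hmk
  have hexp : (fun θ : ℝ => Circle.exp θ) =
      (⇑(Homeomorph.toMeasurableEquiv AddCircle.homeomorphCircle' : AddCircle (2 * π) ≃ᵐ Circle)) ∘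
        (fun θ : ℝ => (θ : AddCircle (2 * π))) := by
    funext θ
    rw [Function.comp_apply, coe_circleEquiv_apply_coe]
  have hmkm : Measurable (fun θ : ℝ => (θ : AddCircle (2 * π))) := AddCircle.measurable_mk'
  rw [hexp, ← Measure.map_map (Homeomorph.toMeasurableEquiv AddCircle.homeomorphCircle').measurable
    hmkm, hmk,
    map_circleEquiv_volume, smul_smul, ENNReal.inv_mul_cancel (by positivity) ENNReal.ofReal_ne_top,
    one_smul]

omit hc in
/-- Restricting Lebesgue measure to `[−π, 0]` is the reflection of its restriction to `[0, π]`. -/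
theorem volume_restrict_Icc_neg_eq_map_neg :
    (volume.restrict (Icc (-π) 0) : Measure ℝ) = Measure.map (fun a : ℝ => -a) (volume.restrict (Icc 0 π)) := by
  have hpre : (fun a : ℝ => -a) ⁻¹' Icc (-π) 0 = Icc 0 π := by
    ext a
    simp only [Set.mem_preimage, Set.mem_Icc]
    constructor <;> intro h <;> constructor <;> linarith [h.1, h.2]
  rw [← hpre, ← Measure.restrict_map measurable_neg measurableSet_Icc, Measure.map_neg_eq_self]

/-- **Haar on the `SU(2)` torus, by Weyl chambers**:
`Haar_{SΔ(2)} = (2π)⁻¹ · ((a ↦ c(e^{ia}))_* Leb|_[0,π] + (a ↦ c(e^{−ia}))_* Leb|_[0,π])` — each chamber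
is presented by the closed Weyl alcove `[0, π]`. -/
theorem haarProbability_su2Torus_eq_alcoves : haarProbability (specialDiagonalTorus (Fin 2)) =
    (ENNReal.ofReal (2 * π))⁻¹ •
      (Measure.map (fun a : ℝ => c (Circle.exp a)) (volume.restrict (Icc 0 π)) +
        Measure.map (fun a : ℝ => c (Circle.exp (-a))) (volume.restrict (Icc 0 π))) := by
  haveI : SecondCountableTopology (specialDiagonalTorus (Fin 2)) := secondCountableTopology_specialDiagonalTorus
  have hcm : Measurable c := (su2TorusChart_surjective_continuous hc).2.measurable
  have hem : Measurable fun θ : ℝ => Circle.exp θ := Circle.exp.continuous.measurable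
  have hcem : Measurable fun a : ℝ => c (Circle.exp a) := hcm.comp hem
  rw [← map_su2TorusChart_haar hc, haarProbability_circle_eq_map_exp, Measure.map_smul,
    Measure.map_map hcm hem, show (c ∘ fun θ : ℝ => Circle.exp θ) = fun a => c (Circle.exp a) from rfl]
  congr 1
  -- split `(−π, π]` at `0`; endpoints are null
  have hsplit : (volume.restrict (Ioc (-π) π) : Measure ℝ) =
      volume.restrict (Icc (-π) 0) + volume.restrict (Icc 0 π) := by
    rw [show (Ioc (-π) π : Set ℝ) = Ioc (-π) 0 ∪ Ioc 0 π from
        (Set.Ioc_union_Ioc_eq_Ioc (by linarith [pi_pos]) (by linarith [pi_pos])).symm,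
      Measure.restrict_union (Set.Ioc_disjoint_Ioc_of_le le_rfl) measurableSet_Ioc,
      Measure.restrict_congr_set Ioc_ae_eq_Icc, Measure.restrict_congr_set Ioc_ae_eq_Icc]
  rw [hsplit, Measure.map_add _ _ hcem, volume_restrict_Icc_neg_eq_map_neg,
    Measure.map_map hcem measurable_neg, add_comm]
  rfl

/-- **`hfJ` for `N = 2`: the torus Jacobian of a Weyl-equivariant `SU(2)` eigen-phase flow.**  Let
`g` be measurable and monotone on the alcove `[0, π]` with `g '' [0,π] = [0,π]` and derivative `g'`
(measurable) within `[0, π]`.  Let `fT : SΔ(2) → SΔ(2)` and `Jf` be measurable with, for `a ∈ [0, π]`,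
`fT (c e^{ia}) = c e^{ig(a)}`, `fT (c e^{−ia}) = c e^{−ig(a)}` (equivariance under the Weyl swap) and
`Jf (c e^{±ia}) = g'(a)`.  Then `HasJacobian (Haar SΔ(2)) fT Jf`. -/
theorem hasJacobian_su2Torus_of_alcoveMap {g g' : ℝ → ℝ} (hg : Measurable g) (hg' : Measurable g')
    (hderiv : ∀ a ∈ Icc 0 π, HasDerivWithinAt g (g' a) (Icc 0 π) a) (hmono : MonotoneOn g (Icc 0 π))
    (himage : g '' Icc 0 π = Icc 0 π)
    {fT : specialDiagonalTorus (Fin 2) → specialDiagonalTorus (Fin 2)} (hfTm : Measurable fT)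
    {Jf : specialDiagonalTorus (Fin 2) → ℝ≥0∞} (hJm : Measurable Jf)
    (hFpos : ∀ a ∈ Icc 0 π, fT (c (Circle.exp a)) = c (Circle.exp (g a)))
    (hFneg : ∀ a ∈ Icc 0 π, fT (c (Circle.exp (-a))) = c (Circle.exp (-(g a))))
    (hJpos : ∀ a ∈ Icc 0 π, Jf (c (Circle.exp a)) = ENNReal.ofReal (g' a))
    (hJneg : ∀ a ∈ Icc 0 π, Jf (c (Circle.exp (-a))) = ENNReal.ofReal (g' a)) :
    HasJacobian (haarProbability (specialDiagonalTorus (Fin 2))) fT Jf := by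
  haveI : SecondCountableTopology (specialDiagonalTorus (Fin 2)) := secondCountableTopology_specialDiagonalTorus
  have hcm : Measurable c := (su2TorusChart_surjective_continuous hc).2.measurable
  have hem : Measurable fun θ : ℝ => Circle.exp θ := Circle.exp.continuous.measurable
  have h1 : HasJacobian (volume.restrict (Icc 0 π)) g fun x => ENNReal.ofReal (g' x) :=
    hasJacobian_volume_restrict_of_monotoneOn measurableSet_Icc hg hg' hderiv hmono himage
  have hae : ∀ {P : ℝ → Prop}, (∀ a ∈ Icc 0 π, P a) → ∀ᵐ a ∂(volume.restrict (Icc 0 π)), P a :=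
    fun h => (ae_restrict_iff' measurableSet_Icc).mpr (Filter.Eventually.of_forall h)
  have hplus : HasJacobian (Measure.map (fun a : ℝ => c (Circle.exp a)) (volume.restrict (Icc 0 π))) fT Jf :=
    hasJacobian_of_presentation_ae (hcm.comp hem) rfl h1 hfTm hJm (hae hFpos) (hae hJpos)
  have hminus : HasJacobian (Measure.map (fun a : ℝ => c (Circle.exp (-a))) (volume.restrict (Icc 0 π))) fT Jf :=
    hasJacobian_of_presentation_ae (e := fun a : ℝ => c (Circle.exp (-a)))
      (hcm.comp (hem.comp measurable_neg)) rfl h1 hfTm hJm (hae hFneg) (hae hJneg)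
  rw [haarProbability_su2Torus_eq_alcoves hc]
  exact (hplus.add hminus).smul_measure _

/-- **The engine's parametrisation (`spectral_kernel`, `N = 2`, `cell = 'simplex'`).**  Let the box
flow `χ` be measurable and monotone on `[0, 1]` with `χ '' [0,1] = [0,1]` and derivative `χ'`
(measurable) within `[0, 1]`; the kernel's alcove map is `g(a) = π(1 − χ(1 − a/π))` and the booked
density is `χ'(1 − a/π)` (`= g'(a)`).  Any measurable `fT`, `Jf` intertwined with `g` on both
chambers as above, with `Jf (c e^{±ia}) = χ'(1 − a/π)`, satisfy `HasJacobian (Haar SΔ(2)) fT Jf`. -/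
theorem hasJacobian_su2Torus_of_boxFlow {χ χ' : ℝ → ℝ} (hχ : Measurable χ) (hχ' : Measurable χ')
    (hderiv : ∀ u ∈ Icc (0 : ℝ) 1, HasDerivWithinAt χ (χ' u) (Icc 0 1) u)
    (hmono : MonotoneOn χ (Icc 0 1)) (himage : χ '' Icc 0 1 = Icc 0 1)
    {fT : specialDiagonalTorus (Fin 2) → specialDiagonalTorus (Fin 2)} (hfTm : Measurable fT)
    {Jf : specialDiagonalTorus (Fin 2) → ℝ≥0∞} (hJm : Measurable Jf)
    (hFpos : ∀ a ∈ Icc 0 π, fT (c (Circle.exp a)) = c (Circle.exp (π * (1 - χ (1 - a / π)))))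
    (hFneg : ∀ a ∈ Icc 0 π, fT (c (Circle.exp (-a))) = c (Circle.exp (-(π * (1 - χ (1 - a / π))))))
    (hJpos : ∀ a ∈ Icc 0 π, Jf (c (Circle.exp a)) = ENNReal.ofReal (χ' (1 - a / π)))
    (hJneg : ∀ a ∈ Icc 0 π, Jf (c (Circle.exp (-a))) = ENNReal.ofReal (χ' (1 - a / π))) :
    HasJacobian (haarProbability (specialDiagonalTorus (Fin 2))) fT Jf := by
  have hπ : (0 : ℝ) < π := pi_pos
  -- the affine reparametrisation `u(a) = 1 − a/π : [0, π] → [0, 1]`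
  have hu_mem : ∀ a ∈ Icc 0 π, 1 - a / π ∈ Icc (0 : ℝ) 1 := by
    intro a ha
    constructor
    · rw [sub_nonneg, div_le_one hπ]; exact ha.2
    · rw [sub_le_self_iff]; exact div_nonneg ha.1 hπ.le
  have hu_maps : MapsTo (fun a : ℝ => 1 - a / π) (Icc 0 π) (Icc 0 1) := fun a ha => hu_mem a ha
  have hu_deriv : ∀ a, HasDerivWithinAt (fun a : ℝ => 1 - a / π) (-(1 / π)) (Icc 0 π) a := by
    intro a
    exact (((hasDerivAt_id' a).div_const π).const_sub 1).hasDerivWithinAt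
  refine hasJacobian_su2Torus_of_alcoveMap hc (g := fun a => π * (1 - χ (1 - a / π)))
    (g' := fun a => χ' (1 - a / π)) ?_ ?_ ?_ ?_ ?_ hfTm hJm hFpos hFneg hJpos hJneg
  · exact measurable_const.mul (measurable_const.sub (hχ.comp (measurable_const.sub
      (measurable_id.div_const π))))
  · exact hχ'.comp (measurable_const.sub (measurable_id.div_const π))
  · intro a ha
    have hcomp : HasDerivWithinAt (fun a : ℝ => χ (1 - a / π)) (χ' (1 - a / π) * -(1 / π)) (Icc 0 π) a :=
      (hderiv _ (hu_mem a ha)).comp a (hu_deriv a) hu_maps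
    have h := (hcomp.const_sub 1).const_mul π
    have h' : π * (-(χ' (1 - a / π) * -(1 / π))) = χ' (1 - a / π) := by
      field_simp
    rw [h'] at h
    exact h
  · intro a ha b hb hab
    have h1 : 1 - b / π ≤ 1 - a / π := by
      apply sub_le_sub_left
      exact div_le_div_of_nonneg_right hab hπ.le
    have h2 := hmono (hu_mem b hb) (hu_mem a ha) h1
    exact mul_le_mul_of_nonneg_left (sub_le_sub_left h2 1) hπ.le
  · -- `g '' [0, π] = [0, π]` from `χ '' [0, 1] = [0, 1]`
    ext y
    constructor
    · rintro ⟨a, ha, rfl⟩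
      have hχa : χ (1 - a / π) ∈ Icc (0 : ℝ) 1 := by
        rw [← himage]; exact ⟨_, hu_mem a ha, rfl⟩
      constructor
      · exact mul_nonneg hπ.le (sub_nonneg.mpr hχa.2)
      · calc π * (1 - χ (1 - a / π)) ≤ π * 1 := by
              apply mul_le_mul_of_nonneg_left _ hπ.le; linarith [hχa.1]
          _ = π := mul_one π
    · intro hy
      -- `y = π(1 − v)` with `v ∈ [0,1]`, `v = χ u`, `u = 1 − a/π`
      have hv : 1 - y / π ∈ Icc (0 : ℝ) 1 := hu_mem y hy
      rw [← himage] at hv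
      obtain ⟨u, hu, huv⟩ := hv
      refine ⟨π * (1 - u), ⟨mul_nonneg hπ.le (sub_nonneg.mpr hu.2), ?_⟩, ?_⟩
      · calc π * (1 - u) ≤ π * 1 := by apply mul_le_mul_of_nonneg_left _ hπ.le; linarith [hu.1]
          _ = π := mul_one π
      · have hu' : 1 - π * (1 - u) / π = u := by field_simp; ring
        simp only [hu', huv]
        field_simp
        ring

end Summit.Ventures.LatticeQCDFlow.Exactness
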